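import Summits.NavierStokesRegularity.NavierStokesRegularity.Theorems.SqueezeCycleExtremalBiaxialitySubcriticalOfLiouville
import Summits.NavierStokesRegularity.NavierStokesRegularity.Theses.SymmetryModuliCount
import HarnessLib

/-!
# Route `SqueezeCycle`, crux `ExtremalBiaxialitySubcritical` — reductions

Helper file for item `stmt-NavierStokesRegularity-11609`
(`Summit.NavierStokesRegularity.NavierStokesRegularity.Theses.SqueezeCycle.ExtremalBiaxialitySubcritical`):
typed reductions locating the content of the crux.

* `extremalBiaxialitySubcritical_bootstrap` — **the quarter bootstrap** (crux idea card
  `quarter-bootstrap-pinning`): the sibling crux `MustSqueeze` is the threshold-`1/8` member of a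
  family `MustSqueeze_a` ("an element of `𝒦_C` with Leray-gauge middle strain eigenvalue `≤ a`
  everywhere vanishes"), whose engine (the `¼`-law in similarity variables) is stated for every
  `a < 1/4`. Given that family for all `a < 1/4`, the crux is implied by — and trivially implies,
  `noMarginalExtremal_of_extremalBiaxialitySubcritical` — the statement
  `NoMarginalExtremal`: "an attained class-wide maximum `m` of the middle eigenvalue is `< 1/4`".
  Indeed if `m < 1/4`, `MustSqueeze_m` applies to the extremal element itself (its maximality
  clause is literally the hypothesis of `MustSqueeze_m`), so it vanishes and `m ≤ 0`.
  The genuine content of the crux therefore sits at attained maxima `m ≥ 1/4`.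
* `squeezeClass_zero`, `nonneg_of_maximal` and `squeezeClass_constant_nonneg` — calibration: the
  zero field belongs to `𝒦_C` exactly when `C ≥ 0`, the class is empty for `C < 0`, and the
  maximality clause of the crux tested on `0` forces `m ≥ 0`.
* `squeezeLiouville_of_typeIAncientLiouville`, `extremalBiaxialitySubcritical_of_typeIAncientLiouville`
  — cross-route link: the target `TypeIAncientLiouville` of routes `SymmetryModuliCount` /
  `ExtremalTypeIConstant` (item stmt-NavierStokesRegularity-4050: Liouville on the larger class
  without scaled energies, i.e. `IsTypeIAncientMild C u → u ≡ 0`) implies this route's target and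
  crux.
-/

noncomputable section

open MeasureTheory Set Function Filter
open scoped RealInnerProductSpace

namespace Summit.NavierStokesRegularity.NavierStokesRegularity.Theorems

open Literature.Analysis.FluidPDE
open Summit.NavierStokesRegularity.NavierStokesRegularity.Theses

/-! ### The quarter bootstrap -/

/-- **The quarter bootstrap** (card `quarter-bootstrap-pinning`, first lemma). Hypotheses:
(i) the `MustSqueeze` family for every threshold `a < 1/4` — an element of `𝒦_C` whose Leray-gauge
middle strain eigenvalue is `≤ a` at every point (Courant–Fischer: the quadratic form of
`(−t)∇u(t,x)` is `≤ a|·|²` on some orthonormal 2-frame) vanishes identically; (ii)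
`NoMarginalExtremal` — the crux with its conclusion weakened to `m < 1/4`. Conclusion: the crux
`ExtremalBiaxialitySubcritical`. Proof: by (ii) the attained maximum satisfies `m < 1/4`; then (i)
at threshold `a = m` applies to the extremal element itself (its maximality clause, specialised to
`v' = u`, is the hypothesis of `MustSqueeze_m`), so `u ≡ 0`, the gradient at `(t₀, x₀)` vanishes
and the attainment clause gives `m ≤ 0 < 1/8`. Pure logic over the route's declarations. [folklore] -/
theorem extremalBiaxialitySubcritical_bootstrap
    (hMS : ∀ a : ℝ, a < 1 / 4 → ∀ (C : ℝ) (u : ℝ → EuclideanSpace ℝ (Fin 3) → EuclideanSpace ℝ (Fin 3)), ContDiffOn ℝ (⊤ : ℕ∞) (Function.uncurry u) (Set.Iio 0 ×ˢ Set.univ) ∧ (∀ t < 0, Literature.Analysis.FluidPDE.VectorCalculus.IsDivFree (u t)) ∧ (∀ s t : ℝ, s < t → t < 0 → ∀ x, u t x = Literature.Analysis.FluidPDE.heatFlow (u s) (t-s) x - ∫ τ in Set.Ioo s t, ∫ y, ((-(inner ℝ (x-y) (u τ y) / (2*(t-τ)) * Literature.Analysis.UnboundedOperators.heatKernel (t-τ)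 (x-y))) • u τ y + (∫ σ in Set.Ioi (t-τ), Literature.Analysis.UnboundedOperators.heatKernel σ (x-y) / (4*σ^2)) • (inner ℝ (x-y) (u τ y) • u τ y + inner ℝ (u τ y) (u τ y) • (x-y) + inner ℝ (x-y) (u τ y) • u τ y) - ((∫ σ in Set.Ioi (t-τ), Literature.Analysis.UnboundedOperators.heatKernel σ (x-y) / (8*σ^3)) * (inner ℝ (x-y) (u τ y) * inner ℝ (x-y) (u τ y))) • (x-y))) ∧ Literature.Analysis.FluidPDE.HasTypeITimeDecay C u ∧ (∀ (x₀ : EuclideanSpace ℝ (Fin 3)) (t₀ r : ℝ), t₀ ≤ 0 → 0 < r → (∀ t, t₀ - r^2 < t → t < t₀ → r⁻¹ * ∫ x in Metric.ball x₀ r, ‖u t x‖^2 ≤ C) ∧ r⁻¹ * ∫ t in Set.Ioo (t₀ - r^2) t₀, ∫ x in Metric.ball x₀ r, ‖fderiv ℝ (u t) x‖^2 ≤ C) → (∀ t < 0, ∀ x, (∃ v w : EuclideanSpace ℝ (Fin 3), ‖v‖ = 1 ∧ ‖w‖ = 1 ∧ inner ℝ v w = 0 ∧ ∀ α β : ℝ,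 (-t) * inner ℝ (fderiv ℝ (u t) x (α • v + β • w)) (α • v + β • w) ≤ a * (α^2 + β^2))) → ∀ t < 0, ∀ x, u t x = 0)
    (hNM : ∀ (C m : ℝ) (u : ℝ → EuclideanSpace ℝ (Fin 3) → EuclideanSpace ℝ (Fin 3)) (t₀ : ℝ) (x₀ : EuclideanSpace ℝ (Fin 3)), t₀ < 0 → (ContDiffOn ℝ (⊤ : ℕ∞) (Function.uncurry u) (Set.Iio 0 ×ˢ Set.univ) ∧ (∀ t < 0, Literature.Analysis.FluidPDE.VectorCalculus.IsDivFree (u t)) ∧ (∀ s t : ℝ, s < t → t < 0 → ∀ x, u t x = Literature.Analysis.FluidPDE.heatFlow (u s) (t-s) x - ∫ τ in Set.Ioo s t, ∫ y, ((-(inner ℝ (x-y) (u τ y) / (2*(t-τ)) * Literature.Analysis.UnboundedOperators.heatKernel (t-τ) (x-y))) • u τ y + (∫ σ in Set.Ioi (t-τ), Literature.Analysis.UnboundedOperators.heatKernel σ (x-y) / (4*σ^2)) • (inner ℝ (x-y) (u τ y) • u τ y + inner ℝ (u τ y) (u τ y) • (x-y) + inner ℝ (x-y) (u τ y) • u τ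 y) - ((∫ σ in Set.Ioi (t-τ), Literature.Analysis.UnboundedOperators.heatKernel σ (x-y) / (8*σ^3)) * (inner ℝ (x-y) (u τ y) * inner ℝ (x-y) (u τ y))) • (x-y))) ∧ Literature.Analysis.FluidPDE.HasTypeITimeDecay C u ∧ (∀ (x₀ : EuclideanSpace ℝ (Fin 3)) (t₀ r : ℝ), t₀ ≤ 0 → 0 < r → (∀ t, t₀ - r^2 < t → t < t₀ → r⁻¹ * ∫ x in Metric.ball x₀ r, ‖u t x‖^2 ≤ C) ∧ r⁻¹ * ∫ t in Set.Ioo (t₀ - r^2) t₀, ∫ x in Metric.ball x₀ r, ‖fderiv ℝ (u t) x‖^2 ≤ C)) → (∃ v w : EuclideanSpace ℝ (Fin 3), ‖v‖ = 1 ∧ ‖w‖ = 1 ∧ inner ℝ v w = 0 ∧ ∀ α β : ℝ, m * (α^2 + β^2) ≤ (-t₀) * inner ℝ (fderiv ℝ (u t₀) x₀ (α • v + β • w)) (α • v + β • w)) → (∀ v' : ℝ → EuclideanSpace ℝ (Fin 3) → EuclideanSpace ℝ (Fin 3), ContDiffOn ℝ (⊤ : ℕ∞) (Function.uncurry v') (Set.Iio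 0 ×ˢ Set.univ) ∧ (∀ t < 0, Literature.Analysis.FluidPDE.VectorCalculus.IsDivFree (v' t)) ∧ (∀ s t : ℝ, s < t → t < 0 → ∀ x, v' t x = Literature.Analysis.FluidPDE.heatFlow (v' s) (t-s) x - ∫ τ in Set.Ioo s t, ∫ y, ((-(inner ℝ (x-y) (v' τ y) / (2*(t-τ)) * Literature.Analysis.UnboundedOperators.heatKernel (t-τ) (x-y))) • v' τ y + (∫ σ in Set.Ioi (t-τ), Literature.Analysis.UnboundedOperators.heatKernel σ (x-y) / (4*σ^2)) • (inner ℝ (x-y) (v' τ y) • v' τ y + inner ℝ (v' τ y) (v' τ y) • (x-y) + inner ℝ (x-y) (v' τ y) • v' τ y) - ((∫ σ in Set.Ioi (t-τ), Literature.Analysis.UnboundedOperators.heatKernel σ (x-y) / (8*σ^3)) * (inner ℝ (x-y) (v' τ y) * inner ℝ (x-y) (v' τ y))) • (x-y))) ∧ Literature.Analysis.FluidPDE.HasTypeITimeDecay C v' ∧ (∀ (x₀ : EuclideanSpace ℝ (Fin 3)) (t₀ r : ℝ), t₀ ≤ 0 → 0 < r → (∀ t, t₀ - r^2 < t → t < t₀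 → r⁻¹ * ∫ x in Metric.ball x₀ r, ‖v' t x‖^2 ≤ C) ∧ r⁻¹ * ∫ t in Set.Ioo (t₀ - r^2) t₀, ∫ x in Metric.ball x₀ r, ‖fderiv ℝ (v' t) x‖^2 ≤ C) → ∀ t < 0, ∀ x, (∃ v w : EuclideanSpace ℝ (Fin 3), ‖v‖ = 1 ∧ ‖w‖ = 1 ∧ inner ℝ v w = 0 ∧ ∀ α β : ℝ, (-t) * inner ℝ (fderiv ℝ (v' t) x (α • v + β • w)) (α • v + β • w) ≤ m * (α^2 + β^2))) → m < 1 / 4) :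
    SqueezeCycle.ExtremalBiaxialitySubcritical := by
  intro C m u t₀ x₀ ht₀ hu hGE hmax
  have hm4 : m < 1 / 4 := hNM C m u t₀ x₀ ht₀ hu hGE hmax
  -- `MustSqueeze_m` applies to the extremal element itself
  have hz : ∀ x, u t₀ x = 0 := fun x => hMS m hm4 C u hu (hmax u hu) t₀ ht₀ x
  have hm : m ≤ 0 := nonpos_of_twoFrame_lower_of_slice_zero hz hGE
  linarith

/-- The converse direction of the bootstrap is trivial: the crux (`m < 1/8` at an attained
maximum) implies `NoMarginalExtremal` (`m < 1/4` at an attained maximum). Together with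
`extremalBiaxialitySubcritical_bootstrap`: given the `MustSqueeze` family below `1/4`, the crux is
EQUIVALENT to the absence of attained class-wide maxima `m ≥ 1/4`. [folklore] -/
theorem noMarginalExtremal_of_extremalBiaxialitySubcritical
    (hX : SqueezeCycle.ExtremalBiaxialitySubcritical) :
    ∀ (C m : ℝ) (u : ℝ → EuclideanSpace ℝ (Fin 3) → EuclideanSpace ℝ (Fin 3)) (t₀ : ℝ) (x₀ : EuclideanSpace ℝ (Fin 3)), t₀ < 0 → (ContDiffOn ℝ (⊤ : ℕ∞) (Function.uncurry u) (Set.Iio 0 ×ˢ Set.univ) ∧ (∀ t < 0, Literature.Analysis.FluidPDE.VectorCalculus.IsDivFree (u t)) ∧ (∀ s t : ℝ, s < t → t < 0 → ∀ x, u t x = Literature.Analysis.FluidPDE.heatFlow (u s) (t-s) x - ∫ τ in Set.Ioo s t, ∫ y, ((-(inner ℝ (x-y) (u τ y) / (2*(t-τ)) * Literature.Analysis.UnboundedOperators.heatKernel (t-τ) (x-y))) • u τ y + (∫ σ in Set.Ioi (t-τ), Literature.Analysis.UnboundedOperators.heatKernel σ (x-y) / (4*σ^2)) • (inner ℝ (x-y)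 (u τ y) • u τ y + inner ℝ (u τ y) (u τ y) • (x-y) + inner ℝ (x-y) (u τ y) • u τ y) - ((∫ σ in Set.Ioi (t-τ), Literature.Analysis.UnboundedOperators.heatKernel σ (x-y) / (8*σ^3)) * (inner ℝ (x-y) (u τ y) * inner ℝ (x-y) (u τ y))) • (x-y))) ∧ Literature.Analysis.FluidPDE.HasTypeITimeDecay C u ∧ (∀ (x₀ : EuclideanSpace ℝ (Fin 3)) (t₀ r : ℝ), t₀ ≤ 0 → 0 < r → (∀ t, t₀ - r^2 < t → t < t₀ → r⁻¹ * ∫ x in Metric.ball x₀ r, ‖u t x‖^2 ≤ C) ∧ r⁻¹ * ∫ t in Set.Ioo (t₀ - r^2) t₀, ∫ x in Metric.ball x₀ r, ‖fderiv ℝ (u t) x‖^2 ≤ C)) → (∃ v w : EuclideanSpace ℝ (Fin 3), ‖v‖ = 1 ∧ ‖w‖ = 1 ∧ inner ℝ v w = 0 ∧ ∀ α β : ℝ, m * (α^2 + β^2) ≤ (-t₀) * inner ℝ (fderiv ℝ (u t₀) x₀ (α • v + β • w)) (α • v + β • w)) → (∀ v' : ℝ → EuclideanSpace ℝ (Fin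 3) → EuclideanSpace ℝ (Fin 3), ContDiffOn ℝ (⊤ : ℕ∞) (Function.uncurry v') (Set.Iio 0 ×ˢ Set.univ) ∧ (∀ t < 0, Literature.Analysis.FluidPDE.VectorCalculus.IsDivFree (v' t)) ∧ (∀ s t : ℝ, s < t → t < 0 → ∀ x, v' t x = Literature.Analysis.FluidPDE.heatFlow (v' s) (t-s) x - ∫ τ in Set.Ioo s t, ∫ y, ((-(inner ℝ (x-y) (v' τ y) / (2*(t-τ)) * Literature.Analysis.UnboundedOperators.heatKernel (t-τ) (x-y))) • v' τ y + (∫ σ in Set.Ioi (t-τ), Literature.Analysis.UnboundedOperators.heatKernel σ (x-y) / (4*σ^2)) • (inner ℝ (x-y) (v' τ y) • v' τ y + inner ℝ (v' τ y) (v' τ y) • (x-y) + inner ℝ (x-y) (v' τ y) • v' τ y) - ((∫ σ in Set.Ioi (t-τ), Literature.Analysis.UnboundedOperators.heatKernel σ (x-y) / (8*σ^3)) * (inner ℝ (x-y) (v' τ y) * inner ℝ (x-y) (v' τ y))) • (x-y))) ∧ Literature.Analysis.FluidPDE.HasTypeITimeDecay C v' ∧ (∀ (x₀ : EuclideanSpace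 ℝ (Fin 3)) (t₀ r : ℝ), t₀ ≤ 0 → 0 < r → (∀ t, t₀ - r^2 < t → t < t₀ → r⁻¹ * ∫ x in Metric.ball x₀ r, ‖v' t x‖^2 ≤ C) ∧ r⁻¹ * ∫ t in Set.Ioo (t₀ - r^2) t₀, ∫ x in Metric.ball x₀ r, ‖fderiv ℝ (v' t) x‖^2 ≤ C) → ∀ t < 0, ∀ x, (∃ v w : EuclideanSpace ℝ (Fin 3), ‖v‖ = 1 ∧ ‖w‖ = 1 ∧ inner ℝ v w = 0 ∧ ∀ α β : ℝ, (-t) * inner ℝ (fderiv ℝ (v' t) x (α • v + β • w)) (α • v + β • w) ≤ m * (α^2 + β^2))) → m < 1 / 4 := by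
  intro C m u t₀ x₀ ht₀ hu hGE hmax
  have h := hX C m u t₀ x₀ ht₀ hu hGE hmax
  linarith

/-! ### Calibration: the zero element and the sign of `m` -/

/-- **The zero field belongs to `𝒦_C` for every `C ≥ 0`** (all clauses: `0` is smooth,
divergence free, solves the Oseen identity — `isTypeIAncientMild_zero` — has the Type-I rate,
and its scaled energies vanish). Non-vacuity of the class. [folklore] -/
theorem squeezeClass_zero {C : ℝ} (hC : 0 ≤ C) :
    ContDiffOn ℝ (⊤ : ℕ∞) (Function.uncurry (0 : ℝ → EuclideanSpace ℝ (Fin 3) → EuclideanSpace ℝ (Fin 3))) (Set.Iio 0 ×ˢ Set.univ) ∧ (∀ t < 0, Literature.Analysis.FluidPDE.VectorCalculus.IsDivFree ((0 : ℝ → EuclideanSpace ℝ (Fin 3) → EuclideanSpace ℝ (Fin 3)) t)) ∧ (∀ s t : ℝ, s < t → t < 0 → ∀ x, (0 : ℝ → EuclideanSpace ℝ (Fin 3) → EuclideanSpace ℝ (Fin 3)) t x = Literature.Analysis.FluidPDE.heatFlow ((0 : ℝ → EuclideanSpace ℝ (Fin 3) → EuclideanSpace ℝ (Fin 3)) s)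 (t-s) x - ∫ τ in Set.Ioo s t, ∫ y, ((-(inner ℝ (x-y) ((0 : ℝ → EuclideanSpace ℝ (Fin 3) → EuclideanSpace ℝ (Fin 3)) τ y) / (2*(t-τ)) * Literature.Analysis.UnboundedOperators.heatKernel (t-τ) (x-y))) • (0 : ℝ → EuclideanSpace ℝ (Fin 3) → EuclideanSpace ℝ (Fin 3)) τ y + (∫ σ in Set.Ioi (t-τ), Literature.Analysis.UnboundedOperators.heatKernel σ (x-y) / (4*σ^2)) • (inner ℝ (x-y) ((0 : ℝ → EuclideanSpace ℝ (Fin 3) → EuclideanSpace ℝ (Fin 3)) τ y) • (0 : ℝ → EuclideanSpace ℝ (Fin 3) → EuclideanSpace ℝ (Fin 3)) τ y + inner ℝ ((0 : ℝ → EuclideanSpace ℝ (Fin 3) → EuclideanSpace ℝ (Fin 3)) τ y) ((0 : ℝ → EuclideanSpace ℝ (Fin 3) → EuclideanSpace ℝ (Fin 3)) τ y) • (x-y) + inner ℝ (x-y) ((0 : ℝ → EuclideanSpace ℝ (Fin 3) → EuclideanSpace ℝ (Fin 3)) τ y) • (0 : ℝ → EuclideanSpace ℝ (Fin 3) → EuclideanSpace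 ℝ (Fin 3)) τ y) - ((∫ σ in Set.Ioi (t-τ), Literature.Analysis.UnboundedOperators.heatKernel σ (x-y) / (8*σ^3)) * (inner ℝ (x-y) ((0 : ℝ → EuclideanSpace ℝ (Fin 3) → EuclideanSpace ℝ (Fin 3)) τ y) * inner ℝ (x-y) ((0 : ℝ → EuclideanSpace ℝ (Fin 3) → EuclideanSpace ℝ (Fin 3)) τ y))) • (x-y))) ∧ Literature.Analysis.FluidPDE.HasTypeITimeDecay C (0 : ℝ → EuclideanSpace ℝ (Fin 3) → EuclideanSpace ℝ (Fin 3)) ∧ (∀ (x₀ : EuclideanSpace ℝ (Fin 3)) (t₀ r : ℝ), t₀ ≤ 0 → 0 < r → (∀ t, t₀ - r^2 < t → t < t₀ → r⁻¹ * ∫ x in Metric.ball x₀ r, ‖(0 : ℝ → EuclideanSpace ℝ (Fin 3) → EuclideanSpace ℝ (Fin 3)) t x‖^2 ≤ C) ∧ r⁻¹ * ∫ t in Set.Ioo (t₀ - r^2) t₀, ∫ x in Metric.ball x₀ r, ‖fderiv ℝ ((0 : ℝ → EuclideanSpace ℝ (Fin 3) → EuclideanSpace ℝ (Fin 3)) t)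 x‖^2 ≤ C) := by
  have h0 : IsTypeIAncientMild C (0 : ℝ → EuclideanSpace ℝ (Fin 3) → EuclideanSpace ℝ (Fin 3)) :=
    isTypeIAncientMild_zero hC
  rw [isTypeIAncientMild_iff] at h0
  obtain ⟨h1, h2, h3, h4⟩ := h0
  refine ⟨h1, h2, fun s t hst ht x => ?_, h4, fun x₀ t₀ r _ _ => ⟨fun t _ _ => ?_, ?_⟩⟩
  · rw [h3 s t hst ht x]
    rfl
  · simpa using hC
  · have e : (fun t => ∫ x in Metric.ball x₀ r,
        ‖fderiv ℝ ((0 : ℝ → EuclideanSpace ℝ (Fin 3) → EuclideanSpace ℝ (Fin 3)) t) x‖ ^ 2) =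
        fun _ => 0 := by
      funext t
      simp
    rw [e]
    simpa using hC

/-- **The Type-I constant of an inhabited class is nonnegative**: an element of `𝒦_C` has
`‖u(−1, 0)‖ ≤ C`; in particular `𝒦_C = ∅` for `C < 0`, where every statement over the class is
vacuous. [folklore] -/
theorem squeezeClass_constant_nonneg {C : ℝ}
    {u : ℝ → EuclideanSpace ℝ (Fin 3) → EuclideanSpace ℝ (Fin 3)}
    (h4 : Literature.Analysis.FluidPDE.HasTypeITimeDecay C u) : 0 ≤ C := by
  have h1 := h4 (-1) (by norm_num) 0
  rw [neg_neg, Real.sqrt_one, div_one] at h1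
  exact (norm_nonneg _).trans h1

/-- **The maximality clause tested on the zero element forces `m ≥ 0`**: if every element of
`𝒦_C` (with `C ≥ 0`, so that `0 ∈ 𝒦_C`, `squeezeClass_zero`) has Leray-gauge middle strain
eigenvalue `≤ m` everywhere in the crux's Courant–Fischer form, then `0 ≤ m` (the quadratic form
of the zero gradient is `0 ≤ m(α² + β²)`; test `α = 1`, `β = 0`). Hence negative `m` never occur
in the crux, and in a world where `𝒦_C = {0}` the attained maximum is exactly `m = 0`. [folklore] -/
theorem nonneg_of_maximal {C m : ℝ} (hC : 0 ≤ C)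
    (hmax : ∀ v' : ℝ → EuclideanSpace ℝ (Fin 3) → EuclideanSpace ℝ (Fin 3), ContDiffOn ℝ (⊤ : ℕ∞) (Function.uncurry v') (Set.Iio 0 ×ˢ Set.univ) ∧ (∀ t < 0, Literature.Analysis.FluidPDE.VectorCalculus.IsDivFree (v' t)) ∧ (∀ s t : ℝ, s < t → t < 0 → ∀ x, v' t x = Literature.Analysis.FluidPDE.heatFlow (v' s) (t-s) x - ∫ τ in Set.Ioo s t, ∫ y, ((-(inner ℝ (x-y) (v' τ y) / (2*(t-τ)) * Literature.Analysis.UnboundedOperators.heatKernel (t-τ) (x-y))) • v' τ y + (∫ σ in Set.Ioi (t-τ), Literature.Analysis.UnboundedOperators.heatKernel σ (x-y) / (4*σ^2)) • (inner ℝ (x-y) (v' τ y) • v' τ y + inner ℝ (v' τ y) (v' τ y) • (x-y) + inner ℝ (x-y) (v' τ y) • v' τ y) - ((∫ σ in Set.Ioi (t-τ), Literature.Analysis.UnboundedOperators.heatKernel σ (x-y) / (8*σ^3)) * (inner ℝ (x-y) (v' τ y) * inner ℝ (x-y) (v' τ y))) • (x-y))) ∧ Literature.Analysis.FluidPDE.HasTypeITimeDecay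 C v' ∧ (∀ (x₀ : EuclideanSpace ℝ (Fin 3)) (t₀ r : ℝ), t₀ ≤ 0 → 0 < r → (∀ t, t₀ - r^2 < t → t < t₀ → r⁻¹ * ∫ x in Metric.ball x₀ r, ‖v' t x‖^2 ≤ C) ∧ r⁻¹ * ∫ t in Set.Ioo (t₀ - r^2) t₀, ∫ x in Metric.ball x₀ r, ‖fderiv ℝ (v' t) x‖^2 ≤ C) → ∀ t < 0, ∀ x, (∃ v w : EuclideanSpace ℝ (Fin 3), ‖v‖ = 1 ∧ ‖w‖ = 1 ∧ inner ℝ v w = 0 ∧ ∀ α β : ℝ, (-t) * inner ℝ (fderiv ℝ (v' t) x (α • v + β • w)) (α • v + β • w) ≤ m * (α^2 + β^2))) :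
    0 ≤ m := by
  obtain ⟨v, w, -, -, -, hαβ⟩ := hmax 0 (squeezeClass_zero hC) (-1) (by norm_num) 0
  have e0 : ((0 : ℝ → EuclideanSpace ℝ (Fin 3) → EuclideanSpace ℝ (Fin 3)) (-1)) =
      fun _ => (0 : EuclideanSpace ℝ (Fin 3)) := rfl
  have h10 := hαβ 1 0
  rw [e0] at h10
  simpa using h10

/-! ### Cross-route link: Liouville on the larger Type-I class -/

/-- **`TypeIAncientLiouville` (stmt-NavierStokesRegularity-4050, routes `SymmetryModuliCount` /
`ExtremalTypeIConstant`) implies this route's target `SqueezeLiouville`**: the former is Liouville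
on the whole Type-I KNSS-mild class (its Oseen clause is written with `oseenKernel`, i.e. it is
`IsTypeIAncientMild C u → u ≡ 0` by `isTypeIAncientMild_iff`), the latter is Liouville on the
subclass `𝒦_C` with bounded scaled energies (`isTypeIAncientMild_of_squeezeClass`). [folklore] -/
theorem squeezeLiouville_of_typeIAncientLiouville (hT : SymmetryModuliCount.TypeIAncientLiouville) :
    SqueezeCycle.SqueezeLiouville := by
  intro C u hu t ht x
  obtain ⟨h1, h2, h3, h4, -⟩ := hu
  have h : IsTypeIAncientMild C u := isTypeIAncientMild_of_squeezeClass h1 h2 h3 h4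
  rw [isTypeIAncientMild_iff] at h
  exact hT C u h t ht x

/-- **`TypeIAncientLiouville` (stmt-NavierStokesRegularity-4050) implies the crux
`ExtremalBiaxialitySubcritical`** (through `SqueezeLiouville`,
`extremalBiaxialitySubcritical_of_squeezeLiouville`). [folklore] -/
theorem extremalBiaxialitySubcritical_of_typeIAncientLiouville
    (hT : SymmetryModuliCount.TypeIAncientLiouville) : SqueezeCycle.ExtremalBiaxialitySubcritical :=
  extremalBiaxialitySubcritical_of_squeezeLiouville (squeezeLiouville_of_typeIAncientLiouville hT)

end Summit.NavierStokesRegularity.NavierStokesRegularity.Theorems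

end
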